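import Summits.Ventures.CertifiedArithmetic.LowPrec.DirectedEnvelope
import Summits.Ventures.CertifiedArithmetic.LowPrec.SRBridge
import Summits.Ventures.CertifiedArithmetic.LowPrec.SRWindow
import HarnessLib

/-!
# The structural spacing law of a minifloat format and the SR envelopes it yields (every format)

HONEST FRAMING (venture CertifiedArithmetic / cell `pub-lowprec`): certified error envelopes and
provably optimal rounding/accumulation schemes for low-precision formats under stated cost models;
every table by two implementations; no hardware or vendor claims.

The kernel certificates of `SRCertificates*.lean` / `SRWindow.lean` / `SRRelativeError.lean`
enumerate the value sets of the OCP 4/6/8-bit formats. This file proves the same facts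
STRUCTURALLY, for EVERY `Format` (so also `Binary16`, `BFloat16`, `Binary32`, where enumeration of
pair tables is out of reach), from the grid description of the directed roundings
(`Directed.lean`, `DirectedEnvelope.lean`) and the bridge `SRBridge.lean`:

* `Format.ruGrid_sub_rdGrid_le` — on the magnitude grid the two directed roundings of `r` differ by
  at most the local spacing `2^s`, `s = shift ⌊r⌋`;
* `MiniFloat.roundUp_sub_roundDown_le` — for `|x| ≤ maxRat` the candidate gap `↑x − ↓x` is at most
  `2^s · quantum`; `…_le_max` — the SPACING LAW `↑x − ↓x ≤ max (quantum) (2u·|x|)` (absolute floor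
  in the subnormal binade, relative `2u = 2^{-m}` above it); `…_le_window` — inside the window
  `|x| ≤ 2^(m+1+J)·quantum` the gap is `≤ 2^J·quantum`; `…_le_top` — everywhere it is
  `≤ 2^(emaxCode−1)·quantum`;
* over the CHM number system `valueSet φ` (the SR substrate of `SRStep`/`SRAccumulation`):
  `valueSet_inHull_iff` (`InHull ↔ |x| ≤ maxRat`), the SPACING LAW on the hull
  `valueSet_gap_le_max : ⌈c⌉ − ⌊c⌋ ≤ max quantum (2u·|c|)` (the hypothesis shape
  `∀ c, InHull F c → ⌈c⌉ − ⌊c⌋ ≤ max q (ρ|c|)` consumed by `SRSecondMoment.lean`), and the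
  sequence-level consequences for every format with NO enumeration: `valueSet_gapLE_top`,
  `valueSet_accVar_le_top` (`accVar ≤ n·G²/4`, `G = 2^(emaxCode−1)·quantum`; E4M3: `G = 32`, the
  constant of `SRCertificatesFP6FP8`), and the WINDOW forms `valueSet_accVar_le_window`
  (`InWindow [−W, W]`, `W = 2^(m+1+J)·quantum ≤ maxRat ⇒ accVar ≤ n·4^J·quantum²/4`) with the
  Chebyshev and exponential tails (`valueSet_prob_dev_ge_le_window`,
  `valueSet_prob_dev_ge_le_exp_window`).

The spacing law is the input of the second-moment analysis of summation ORDER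
(`SRSecondMoment.lean`). References: [ConnollyHighamMary2021] Lemma 4.4; [ArarEtAl2023] §3 (the
`2u` model of SR); [Higham2002ASNA] §2.1; IEEE 754-2019 §3.3.
-/

namespace Literature.ComputerArithmetic.FloatingPoint

namespace Format

variable {φ : Format}

/-- On the magnitude grid, round-up and round-down of `0 ≤ r ≤ maxScaled` differ by at most the
local spacing `2^s`, `s = shift ⌊r⌋`. [folklore] -/
theorem ruGrid_sub_rdGrid_le {r : ℚ} (hr : 0 ≤ r) (hle : r ≤ φ.maxScaled) :
    (φ.ruGrid r : ℚ) - φ.rdGrid r ≤ 2 ^ φ.shift ⌊r⌋.toNat := by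
  have hc : (0 : ℚ) < 2 ^ φ.shift ⌊r⌋.toNat := by positivity
  rw [rdGrid_eq_floor_mul hr hle]
  unfold ruGrid; rw [if_pos hle]
  have h0f : 0 ≤ ⌊r / (2 : ℚ) ^ φ.shift ⌊r⌋.toNat⌋ := Int.floor_nonneg.mpr (div_nonneg hr hc.le)
  have h0c : 0 ≤ ⌈r / (2 : ℚ) ^ φ.shift ⌊r⌋.toNat⌉ := Int.ceil_nonneg (div_nonneg hr hc.le)
  have hcf : ((⌊r / (2 : ℚ) ^ φ.shift ⌊r⌋.toNat⌋.toNat : ℕ) : ℚ)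
      = (⌊r / (2 : ℚ) ^ φ.shift ⌊r⌋.toNat⌋ : ℚ) := by exact_mod_cast Int.toNat_of_nonneg h0f
  have hcc : ((⌈r / (2 : ℚ) ^ φ.shift ⌊r⌋.toNat⌉.toNat : ℕ) : ℚ)
      = (⌈r / (2 : ℚ) ^ φ.shift ⌊r⌋.toNat⌉ : ℚ) := by exact_mod_cast Int.toNat_of_nonneg h0c
  have h1 : (⌈r / (2 : ℚ) ^ φ.shift ⌊r⌋.toNat⌉ : ℚ) ≤ ⌊r / (2 : ℚ) ^ φ.shift ⌊r⌋.toNat⌋ + 1 := by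
    exact_mod_cast Int.ceil_le_floor_add_one _
  push_cast
  rw [hcf, hcc]
  have := mul_le_mul_of_nonneg_right h1 hc.le
  linarith

/-- The local spacing is `1` in the subnormal/first binade and at most `r / 2^m` above it:
`2^(shift ⌊r⌋) ≤ max 1 (r / 2^m)`. [folklore] -/
theorem pow_shift_floor_le_max {r : ℚ} (hr : 0 ≤ r) :
    (2 : ℚ) ^ φ.shift ⌊r⌋.toNat ≤ max 1 (r / 2 ^ φ.manBits) := by
  rcases shift_floor_dichotomy (φ := φ) hr with h0 | hfloor
  · rw [h0, pow_zero]; exact le_max_left _ _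
  · refine le_max_of_le_right ?_
    rw [le_div_iff₀ (by positivity), mul_comm, ← pow_add]
    exact hfloor

/-- A magnitude `n < 2^(m+1+J)` has spacing exponent `shift n ≤ J`. [folklore] -/
theorem shift_le_of_lt_pow {n J : ℕ} (hn : n < 2 ^ (φ.manBits + 1 + J)) : φ.shift n ≤ J := by
  by_cases hge : 2 ^ φ.manBits ≤ n
  · have h1 : 2 ^ (φ.manBits + φ.shift n) < 2 ^ (φ.manBits + 1 + J) :=
      lt_of_le_of_lt (pow_shift_le hge) hn
    have := (Nat.pow_lt_pow_iff_right (by norm_num : 1 < 2)).mp h1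
    omega
  · have : φ.shift n = 0 := shift_eq_zero_of_lt (by rw [pow_succ]; omega)
    omega

/-- WINDOW SPACING on the grid: for `0 ≤ r ≤ 2^(m+1+J) ≤ maxScaled` the two directed roundings
differ by at most `2^J` (at the window edge `r = 2^(m+1+J)` the point is itself on the grid).
[folklore] -/
theorem ruGrid_sub_rdGrid_le_window {r : ℚ} (hr : 0 ≤ r) {J : ℕ}
    (hW : r ≤ (2 : ℚ) ^ (φ.manBits + 1 + J)) (hmax : 2 ^ (φ.manBits + 1 + J) ≤ φ.maxScaled) :
    (φ.ruGrid r : ℚ) - φ.rdGrid r ≤ 2 ^ J := by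
  have hle : r ≤ φ.maxScaled := hW.trans (by exact_mod_cast hmax)
  by_cases hlt : ⌊r⌋.toNat < 2 ^ (φ.manBits + 1 + J)
  · refine (ruGrid_sub_rdGrid_le hr hle).trans ?_
    exact pow_le_pow_right₀ (by norm_num) (shift_le_of_lt_pow hlt)
  · -- the floor reaches the window edge, so `r` IS the edge, a grid point
    have hge : ((2 ^ (φ.manBits + 1 + J) : ℕ) : ℚ) ≤ r :=
      natCast_le_of_le_floor_toNat hr (not_lt.mp hlt)
    push_cast at hge
    have hreq : r = ((2 ^ φ.manBits * 2 ^ (J + 1) : ℕ) : ℚ) := by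
      push_cast; rw [← pow_add]
      have : φ.manBits + (J + 1) = φ.manBits + 1 + J := by omega
      rw [this]; exact le_antisymm hW hge
    have hrep : φ.Representable (2 ^ φ.manBits * 2 ^ (J + 1)) := by
      refine MiniFloat.representable_mul_pow (Nat.pow_lt_pow_right (by norm_num) (by omega)) ?_
      rw [← pow_add]
      have : φ.manBits + (J + 1) = φ.manBits + 1 + J := by omega
      rw [this]; exact hmax
    rw [hreq, rdGrid_eq_self_of_representable hrep, ruGrid_eq_self_of_representable hrep, sub_self]
    positivity

/-- `2u = 2^{-m}`: twice the unit roundoff is the relative spacing of the normal range.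
[folklore] -/
theorem two_mul_unitRoundoff (φ : Format) : 2 * φ.unitRoundoff = 1 / 2 ^ φ.manBits := by
  unfold unitRoundoff
  rw [neg_add, zpow_add₀ (by norm_num : (2 : ℚ) ≠ 0), zpow_neg, zpow_natCast, zpow_neg, zpow_one]
  field_simp

end Format

namespace MiniFloat

open Format

variable {φ : Format}

/-- The candidate gap in grid terms: `↑x − ↓x = (ruGrid r − rdGrid r) · quantum`, `r = |x|/quantum`
(both signs). [folklore] -/
theorem roundUp_sub_roundDown_eq (x : ℚ) : (roundUp φ x).toRat - (roundDown φ x).toRat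
    = ((φ.ruGrid (|x| / φ.quantum) : ℚ) - φ.rdGrid (|x| / φ.quantum)) * φ.quantum := by
  rw [toRat_roundUp, toRat_roundDown]
  by_cases hx : x < 0
  · rw [if_pos hx, if_pos hx]; ring
  · rw [if_neg hx, if_neg hx]; ring

/-- GAP ≤ LOCAL SPACING: for `|x| ≤ maxRat`, `↑x − ↓x ≤ 2^s · quantum` with `s` the spacing
exponent of the binade of `|x|`. [folklore] -/
theorem roundUp_sub_roundDown_le {x : ℚ} (h : |x| ≤ φ.maxRat) :
    (roundUp φ x).toRat - (roundDown φ x).toRat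
      ≤ 2 ^ φ.shift ⌊|x| / φ.quantum⌋.toNat * φ.quantum := by
  have hq := φ.quantum_pos
  have hr : 0 ≤ |x| / φ.quantum := div_nonneg (abs_nonneg x) hq.le
  have hle : |x| / φ.quantum ≤ φ.maxScaled := by rw [div_le_iff₀ hq]; exact h
  rw [roundUp_sub_roundDown_eq]
  exact mul_le_mul_of_nonneg_right (Format.ruGrid_sub_rdGrid_le hr hle) hq.le

/-- **THE SPACING LAW** of a minifloat format: for `|x| ≤ maxRat`,
`↑x − ↓x ≤ max (quantum) (2u · |x|)` — an absolute floor `quantum` (subnormal and first binade)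
and the relative spacing `2u = 2^{-m}` above. Every format, no enumeration. [folklore] -/
theorem roundUp_sub_roundDown_le_max {x : ℚ} (h : |x| ≤ φ.maxRat) :
    (roundUp φ x).toRat - (roundDown φ x).toRat ≤ max φ.quantum (2 * φ.unitRoundoff * |x|) := by
  have hq := φ.quantum_pos
  have hr : 0 ≤ |x| / φ.quantum := div_nonneg (abs_nonneg x) hq.le
  refine (roundUp_sub_roundDown_le h).trans ?_
  have h1 := mul_le_mul_of_nonneg_right (Format.pow_shift_floor_le_max (φ := φ) hr) hq.le
  refine h1.trans (le_of_eq ?_)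
  rw [max_mul_of_nonneg _ _ hq.le, one_mul, Format.two_mul_unitRoundoff]
  congr 1
  field_simp

/-- WINDOW SPACING: if `|x| ≤ W = 2^(m+1+J) · quantum ≤ maxRat` then `↑x − ↓x ≤ 2^J · quantum`.
[folklore] -/
theorem roundUp_sub_roundDown_le_window {x : ℚ} {J : ℕ}
    (hW : |x| ≤ 2 ^ (φ.manBits + 1 + J) * φ.quantum)
    (hmax : 2 ^ (φ.manBits + 1 + J) ≤ φ.maxScaled) :
    (roundUp φ x).toRat - (roundDown φ x).toRat ≤ 2 ^ J * φ.quantum := by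
  have hq := φ.quantum_pos
  have hr : 0 ≤ |x| / φ.quantum := div_nonneg (abs_nonneg x) hq.le
  have hW' : |x| / φ.quantum ≤ (2 : ℚ) ^ (φ.manBits + 1 + J) := by rwa [div_le_iff₀ hq]
  rw [roundUp_sub_roundDown_eq]
  exact mul_le_mul_of_nonneg_right (Format.ruGrid_sub_rdGrid_le_window hr hW' hmax) hq.le

/-- GLOBAL SPACING: for `|x| ≤ maxRat`, `↑x − ↓x ≤ 2^(emaxCode − 1) · quantum` (the spacing of the
top binade). [folklore] -/
theorem roundUp_sub_roundDown_le_top {x : ℚ} (h : |x| ≤ φ.maxRat) :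
    (roundUp φ x).toRat - (roundDown φ x).toRat ≤ 2 ^ (φ.emaxCode - 1) * φ.quantum := by
  refine (roundUp_sub_roundDown_le h).trans ?_
  exact mul_le_mul_of_nonneg_right (pow_le_pow_right₀ (by norm_num) (Format.shift_le _))
    φ.quantum_pos.le

/-- The value set is nonempty. [folklore] -/
theorem valueSet_nonempty (φ : Format) : (valueSet φ).Nonempty := ⟨_, toRat_mem_valueSet (top φ)⟩

/-- `maxRat` is a value. [folklore] -/
theorem maxRat_mem_valueSet (φ : Format) : φ.maxRat ∈ valueSet φ := by
  have h := toRat_mem_valueSet (ofScaled φ false φ.maxScaled le_rfl)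
  rw [toRat_ofScaled _ (representable_maxScaled φ)] at h
  unfold Format.maxRat; simpa using h

/-- `−maxRat` is a value. [folklore] -/
theorem neg_maxRat_mem_valueSet (φ : Format) : -φ.maxRat ∈ valueSet φ := by
  have h := toRat_mem_valueSet (ofScaled φ true φ.maxScaled le_rfl)
  rw [toRat_ofScaled _ (representable_maxScaled φ)] at h
  unfold Format.maxRat; rw [← neg_mul]; simpa using h

end MiniFloat

end Literature.ComputerArithmetic.FloatingPoint

namespace Summit.Ventures.CertifiedArithmetic.LowPrec.SR

open Literature.ComputerArithmetic.ConnollyHighamMary2021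
open Literature.ComputerArithmetic.FloatingPoint
open Finset

/-! ### The SR substrate over `valueSet φ` -/

/-- The representable hull of `valueSet φ` is `[−maxRat, maxRat]`. [folklore] -/
theorem valueSet_inHull_iff (φ : Format) (x : ℚ) :
    InHull (MiniFloat.valueSet φ) x ↔ |x| ≤ φ.maxRat := by
  constructor
  · rintro ⟨⟨y, hy, hyx⟩, z, hz, hxz⟩
    obtain ⟨y', rfl⟩ := MiniFloat.mem_valueSet.mp hy
    obtain ⟨z', rfl⟩ := MiniFloat.mem_valueSet.mp hz
    have h1 := MiniFloat.abs_toRat_le_maxRat y'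
    have h2 := MiniFloat.abs_toRat_le_maxRat z'
    rw [abs_le] at h1 h2 ⊢
    exact ⟨h1.1.trans hyx, hxz.trans h2.2⟩
  · intro h
    rw [abs_le] at h
    exact ⟨⟨_, MiniFloat.neg_maxRat_mem_valueSet φ, h.1⟩, _, MiniFloat.maxRat_mem_valueSet φ, h.2⟩

section Generic

variable {K : Type*} [Field K] [LinearOrder K] [IsStrictOrderedRing K]

omit [IsStrictOrderedRing K] in
/-- `GapLE G` on every branch from a gap bound valid on the whole hull. -/
theorem gapLE_of_hull {F : Finset K} (hF : F.Nonempty) {G : K}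
    (hgap : ∀ c, InHull F c → roundUp F c - roundDown F c ≤ G) :
    ∀ (x : ℕ → K) (n : ℕ) (s : K), GapLE F G x n s := by
  intro x n
  induction n generalizing x with
  | zero => intro s; trivial
  | succ n ih =>
      intro s
      exact ⟨hgap _ (clamp_inHull hF _), ih _ _, ih _ _⟩

omit [IsStrictOrderedRing K] in
/-- `InWindow [lo, hi] ⇒ GapLE G` from a gap bound valid on the window (no successor table
needed). -/
theorem gapLE_of_inWindow {F : Finset K} (hF : F.Nonempty) {lo hi G : K}
    (hgap : ∀ c, InHull F c → lo ≤ c → c ≤ hi → roundUp F c - roundDown F c ≤ G) :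
    ∀ (x : ℕ → K) (n : ℕ) (s : K), InWindow F lo hi x n s → GapLE F G x n s := by
  intro x n
  induction n generalizing x with
  | zero => intro s _; trivial
  | succ n ih =>
      intro s h
      obtain ⟨⟨h1, h2⟩, hu, hd⟩ := h
      exact ⟨hgap _ (clamp_inHull hF _) h1 h2, ih _ _ hu, ih _ _ hd⟩

end Generic

/-! ### Every format: spacing law, global and window envelopes (no enumeration) -/

/-- The CHM candidate gap over `valueSet φ` on the hull is the format's `↑c − ↓c`. [folklore] -/
theorem valueSet_gap_eq (φ : Format) {c : ℚ} (hc : InHull (MiniFloat.valueSet φ) c) :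
    roundUp (MiniFloat.valueSet φ) c - roundDown (MiniFloat.valueSet φ) c
      = (Literature.ComputerArithmetic.FloatingPoint.roundUp φ c).toRat
        - (Literature.ComputerArithmetic.FloatingPoint.roundDown φ c).toRat := by
  have h := (valueSet_inHull_iff φ c).mp hc
  rw [MiniFloat.chm_roundUp_eq h, MiniFloat.chm_roundDown_eq h]

/-- **SPACING LAW of every minifloat format** as a CHM number system: on the hull,
`⌈c⌉ − ⌊c⌋ ≤ max quantum (2u·|c|)` — absolute floor `quantum`, relative spacing `2u = 2^{-m}`.
This is the hypothesis shape `∀ c, InHull F c → ⌈c⌉ − ⌊c⌋ ≤ max q (ρ|c|)` of the second-moment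
analysis of summation order (`SRSecondMoment.lean`), with `(q, ρ) = (quantum, 2u)`. -/
theorem valueSet_gap_le_max (φ : Format) {c : ℚ} (hc : InHull (MiniFloat.valueSet φ) c) :
    roundUp (MiniFloat.valueSet φ) c - roundDown (MiniFloat.valueSet φ) c
      ≤ max φ.quantum (2 * φ.unitRoundoff * |c|) := by
  rw [valueSet_gap_eq φ hc]
  exact MiniFloat.roundUp_sub_roundDown_le_max ((valueSet_inHull_iff φ c).mp hc)

/-- Global gap bound on the hull: `⌈c⌉ − ⌊c⌋ ≤ 2^(emaxCode−1) · quantum`. -/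
theorem valueSet_gap_le_top (φ : Format) {c : ℚ} (hc : InHull (MiniFloat.valueSet φ) c) :
    roundUp (MiniFloat.valueSet φ) c - roundDown (MiniFloat.valueSet φ) c
      ≤ 2 ^ (φ.emaxCode - 1) * φ.quantum := by
  rw [valueSet_gap_eq φ hc]
  exact MiniFloat.roundUp_sub_roundDown_le_top ((valueSet_inHull_iff φ c).mp hc)

/-- Window gap bound: `|c| ≤ 2^(m+1+J)·quantum ≤ maxRat ⇒ ⌈c⌉ − ⌊c⌋ ≤ 2^J · quantum`. -/
theorem valueSet_gap_le_window (φ : Format) {J : ℕ} (hmax : 2 ^ (φ.manBits + 1 + J) ≤ φ.maxScaled)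
    {c : ℚ} (hW : |c| ≤ 2 ^ (φ.manBits + 1 + J) * φ.quantum) :
    roundUp (MiniFloat.valueSet φ) c - roundDown (MiniFloat.valueSet φ) c ≤ 2 ^ J * φ.quantum := by
  have hle : |c| ≤ φ.maxRat :=
    hW.trans (mul_le_mul_of_nonneg_right (by exact_mod_cast hmax) φ.quantum_pos.le)
  rw [valueSet_gap_eq φ ((valueSet_inHull_iff φ c).mpr hle)]
  exact MiniFloat.roundUp_sub_roundDown_le_window hW hmax

/-- `GapLE (2^(emaxCode−1)·quantum)` along every branch, every input stream, every format. -/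
theorem valueSet_gapLE_top (φ : Format) (x : ℕ → ℚ) (n : ℕ) (s : ℚ) :
    GapLE (MiniFloat.valueSet φ) (2 ^ (φ.emaxCode - 1) * φ.quantum) x n s :=
  gapLE_of_hull (MiniFloat.valueSet_nonempty φ) (fun _ hc => valueSet_gap_le_top φ hc) x n s

/-- **Global √n variance envelope, every format**: `accVar ≤ n · G²/4` with
`G = 2^(emaxCode−1)·quantum` (E4M3: `G = 32`, the enumerated constant of `SRCertificatesFP6FP8`;
Binary16: `G = 32`). -/
theorem valueSet_accVar_le_top (φ : Format) (x : ℕ → ℚ) (n : ℕ) (s : ℚ) :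
    accVar (MiniFloat.valueSet φ) x n s ≤ n * (2 ^ (φ.emaxCode - 1) * φ.quantum) ^ 2 / 4 :=
  accVar_le _ _ x n s (valueSet_gapLE_top φ x n s)

/-- **Window envelope, every format**: if along every branch every (clamped) pre-rounding value
lies in `[−W, W]`, `W = 2^(m+1+J)·quantum ≤ maxRat`, then `GapLE (2^J·quantum)`. -/
theorem valueSet_gapLE_window (φ : Format) {J : ℕ} (hmax : 2 ^ (φ.manBits + 1 + J) ≤ φ.maxScaled)
    (x : ℕ → ℚ) (n : ℕ) (s : ℚ)
    (hw : InWindow (MiniFloat.valueSet φ) (-(2 ^ (φ.manBits + 1 + J) * φ.quantum))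
      (2 ^ (φ.manBits + 1 + J) * φ.quantum) x n s) :
    GapLE (MiniFloat.valueSet φ) (2 ^ J * φ.quantum) x n s :=
  gapLE_of_inWindow (MiniFloat.valueSet_nonempty φ)
    (fun _ _ h1 h2 => valueSet_gap_le_window φ hmax (abs_le.mpr ⟨h1, h2⟩)) x n s hw

/-- … hence `accVar ≤ n · (2^J·quantum)²/4` on the window. -/
theorem valueSet_accVar_le_window (φ : Format) {J : ℕ}
    (hmax : 2 ^ (φ.manBits + 1 + J) ≤ φ.maxScaled) (x : ℕ → ℚ) (n : ℕ) (s : ℚ)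
    (hw : InWindow (MiniFloat.valueSet φ) (-(2 ^ (φ.manBits + 1 + J) * φ.quantum))
      (2 ^ (φ.manBits + 1 + J) * φ.quantum) x n s) :
    accVar (MiniFloat.valueSet φ) x n s ≤ n * (2 ^ J * φ.quantum) ^ 2 / 4 :=
  accVar_le _ _ x n s (valueSet_gapLE_window φ hmax x n s hw)

/-- … and the Chebyshev `√n` law `P(|ŝₙ − (s + ∑xᵢ)| ≥ t) ≤ n (2^J·quantum)² / (4t²)` on the
window. -/
theorem valueSet_prob_dev_ge_le_window (φ : Format) {J : ℕ}
    (hmax : 2 ^ (φ.manBits + 1 + J) ≤ φ.maxScaled) (x : ℕ → ℚ) (n : ℕ) (s : ℚ)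
    (h : NoSat (MiniFloat.valueSet φ) x n s)
    (hw : InWindow (MiniFloat.valueSet φ) (-(2 ^ (φ.manBits + 1 + J) * φ.quantum))
      (2 ^ (φ.manBits + 1 + J) * φ.quantum) x n s) {t : ℚ} (ht : 0 < t) :
    accExp (MiniFloat.valueSet φ) x n (devInd t (s + ∑ i ∈ range n, x i)) s
      ≤ n * (2 ^ J * φ.quantum) ^ 2 / (4 * t ^ 2) :=
  prob_dev_ge_le _ _ x n s h (valueSet_gapLE_window φ hmax x n s hw) ht

/-- … and the exponential tail `≤ 2·exp(−2t² / (n (2^J·quantum)²))` on the window. -/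
theorem valueSet_prob_dev_ge_le_exp_window (φ : Format) {J : ℕ}
    (hmax : 2 ^ (φ.manBits + 1 + J) ≤ φ.maxScaled) (x : ℕ → ℚ) (n : ℕ) (s : ℚ)
    (h : NoSat (MiniFloat.valueSet φ) x n s)
    (hw : InWindow (MiniFloat.valueSet φ) (-(2 ^ (φ.manBits + 1 + J) * φ.quantum))
      (2 ^ (φ.manBits + 1 + J) * φ.quantum) x n s) (t : ℚ) (ht : 0 < t) :
    ((accExp (MiniFloat.valueSet φ) x n (devInd t (s + ∑ i ∈ range n, x i)) s : ℚ) : ℝ)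
      ≤ 2 * Real.exp (-2 * (t : ℝ) ^ 2 / (n * ((2 ^ J * φ.quantum : ℚ) : ℝ) ^ 2)) :=
  prob_dev_ge_le_exp_rat _ _ x n s h (valueSet_gapLE_window φ hmax x n s hw) t ht


end Summit.Ventures.CertifiedArithmetic.LowPrec.SR
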